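import Literature.Computability.AlgebraicComplexity.RectangularExponentUnidimensionalAsymptotics
import Literature.Computability.AlgebraicComplexity.SchonhageRectangular
import Literature.Computability.AlgebraicComplexity.SchoenhageExampleProofs
import Literature.Computability.AlgebraicComplexity.BorderRankRestriction
import Literature.Computability.AlgebraicComplexity.AsymptoticRankBorderRank
import Literature.Barriers.MatrixMultiplication.UniversalMethodBarrierThm29
import Mathlib.Analysis.SpecialFunctions.Log.Base
import HarnessLib

/-!
# Lotti–Romani 1983, Prop. 4.1 `inf_{x→∞} [f(x) − x] = 1` — proved (discharge of `LottiRomani1983_prop41`)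

Topic `Literature/Computability/AlgebraicComplexity`. Sibling of
`RectangularExponentUnidimensionalAsymptotics.lean`, which vendors G. Lotti, F. Romani, *On the
asymptotic complexity of rectangular matrix multiplication*, TCS 23 (1983), Prop. 4.1 —
`inf_{x→∞} [f(x) − x] = 1` for `f(x) = B(1, x, 1) = ω_ℂ(1, x, 1)` — as the named fact
`LottiRomani1983_prop41`. This file DISCHARGES it (`LottiRomani1983_prop41_holds`), following the
printed proof (held text `paper:doi-10-1016-0304-3975-83-90054-3`, p. 181):

> *Proof.* Consider the decomposition of Example 3.2 with `k = n`, we can write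
> `B(u ln n, 2(1−u) ln(n−1), u ln n) ≤ ln(1+n²) + u ln u + (1−u) ln(1−u)` and
> `f(2(1−u) ln(n−1) / (u ln n)) ≤ [ln(1+n²) + u ln u + (1−u) ln(1−u)] / (u ln n)`.
> Let `u = 2/n`, then `f(x_n) ≤ y_n`, where `x_n = (n−2) ln(n−1)/ln n = (n−2)(1+O(1/n))`, … and
> `y_n − x_n = 1 + O(1/ln n)`. ∎

Example 3.2 (p. 177) is Schönhage's decomposition `t = ⟨k,1,n⟩ ⊕ ⟨1,m,1⟩`, `m = (k−1)(n−1)`,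
`R̲(t) ≤ kn + 1`, pushed through the paper's Prop. 3.3 (the rectangular asymptotic sum inequality
for sums of different formats: the `S`-th tensor power of `t`, grouped by the type `(uS, (1−u)S)` of
its words, `S → ∞`).

## How the printed proof is followed (tree bricks only; theorems only, no new definitions or facts)

* Example 3.2 with `k = n`: `E_n = ⟨n,1,n⟩ ⊕ ⟨1,(n−1)²,1⟩`, `R₂(E_n) ≤ n² + 1` — the tree's
  `approxRank_two_schoenhageExample_le` (BCS (15.12), `SchoenhageExampleProofs.lean`).
* `u = 2/n`: in the `n`-th tensor power `E_n^{⊗n}` the words of type `(2, n−2)` (two letters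
  `⟨n,1,n⟩`, `n−2` letters `⟨1,(n−1)²,1⟩`) form the block
  `C(n,2) ⊙ ⟨n², (n−1)^{2(n−2)}, n²⟩`, a RESTRICTION of `E_n^{⊗n}` (the tree's
  `tensorRestrictsTo_kroneckerPow_matMulDirectSum_multiple`, the block-extraction step of
  Bläser 2013, proof of Thm. 7.5, `UniversalMethodBarrierThm29.lean`), so
  `R̃ ≤ R_{2n} ≤ R₂(E_n)^n ≤ (n²+1)^n` (`asymptoticRank_le_approxRank`,
  `TensorRestrictsTo.approxRank_le`, `approxRank_kroneckerPow_le`).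
* Prop. 3.3 ↦ the tree's rectangular asymptotic sum inequality for EQUAL summands
  (`mul_rpow_omegaRect_mid_le_asymptoticRank`, Schönhage 1981 / ADVXXZ 2025 Thm. 3.2):
  `C(n,2) · (n²)^{ω(1, x_n, 1)} ≤ (n²+1)^n` with `(n²)^{x_n} = (n−1)^{2(n−2)}`, i.e. exactly the
  printed `x_n = (n−2) ln(n−1) / ln n`.  DEVIATION (shorter road, same limit): the printed bound uses
  the `S → ∞` entropy `u ln u + (1−u) ln(1−u)` of Prop. 3.3; here the single power `S = n` with the
  exact multiplicity `C(n,2)` is used, giving `f(x_n) − x_n ≤ 1 + 9/(2 ln n)` instead of the printed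
  `1 + O(1/ln n)` with a slightly better constant — the statement proved, `inf = 1`, is the printed one.
* §2 of the paper (`f` antitone after subtracting `x`, `f(x) ≥ x + 1`; tree
  `omegaRect_one_mid_one_sub_antitone`, `one_le_omegaRect_one_mid_one_sub`) turns the sequence bound
  into the eventual bound and the `liminf`.

The last section restates the result in COPPERSMITH's form (SIAM J. Comput. 11 (1982) p. 471, where Prop. 4.1 is
first stated): for each `β > 0` there is `α > 1` with `R(⟨N, N, ⌈N^α⌉⟩) = O(N^{α+1+β})`
(`Coppersmith1982_exists_isBigO_tensorRank_matMulTensor`; the printed `(log N)^{3/2}` refinement is absorbed by `β`).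

Everything up to `LottiRomani1983_prop41_holds` holds over an ARBITRARY field `K : Type` (Schönhage's example and
the asymptotic sum inequality are field-independent), so the file also records
`liminf_{x→∞} (ω_K(1,x,1) − x) = 1` for every field (`liminf_omegaRect_one_mid_one_sub_eq_one`).

## References

* [LottiRomani1983] G. Lotti, F. Romani, TCS 23 (1983) 171–185 — Example 3.2 (p. 177), Prop. 3.3
  (pp. 176–177), Prop. 4.1 and its proof (pp. 180–181).
* [Coppersmith1982] D. Coppersmith, SIAM J. Comput. 11 (1982) 467–471 — p. 471 (statement).
* [BurgisserClausenShokrollahi1997] (15.12) (Schönhage's example); [Blaser2013] Thm. 7.5 (proof: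
  block extraction), Lemma 7.7; [AlmanDuanVassilevskaWilliamsXuXuZhou2025] Thm. 3.2 (rectangular
  asymptotic sum inequality).
-/

noncomputable section

open scoped BigOperators
open Filter Topology

namespace Literature.Computability.AlgebraicComplexity

open Literature.Barriers.MatrixMultiplication

universe u

/-! ## The block `C(n,2) ⊙ ⟨n², (n−1)^{2(n−2)}, n²⟩` of `E_n^{⊗n}`, `E_n = ⟨n,1,n⟩ ⊕ ⟨1,(n−1)²,1⟩` -/

section Block

/-- The words of type `(2, n−2)` of `E_n^{⊗n}` (two letters `0 = ⟨n,1,n⟩`, placed on a `2`-subset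
of `n̲`, and `n−2` letters `1 = ⟨1,(n−1)²,1⟩`; Lotti–Romani's `u = 2/n`): an injective family of
`C(n,2)` words whose blocks all have the format `⟨n², (n−1)^{2(n−2)}, n²⟩`. [folklore] -/
private theorem exists_typeTwoWords (n : ℕ) :
    ∃ rep : Fin (n.choose 2) → (Fin n → Fin 2), Function.Injective rep ∧
      (∀ β, ∏ j, (![n, 1] : Fin 2 → ℕ) (rep β j) = n ^ 2) ∧
      (∀ β, ∏ j, (![1, (n - 1) * (n - 1)] : Fin 2 → ℕ) (rep β j) = ((n - 1) * (n - 1)) ^ (n - 2)) := by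
  classical
  -- the `2`-subsets of `n̲`, `C(n,2)` of them
  set T : Finset (Finset (Fin n)) := (Finset.univ : Finset (Fin n)).powersetCard 2 with hT
  have hcard : T.card = n.choose 2 := by simp [hT, Finset.card_powersetCard]
  set e := T.equivFinOfCardEq hcard with he
  -- the word of a subset: letter `0` on it, letter `1` off it
  set word : Finset (Fin n) → (Fin n → Fin 2) := fun s j => if j ∈ s then 0 else 1 with hword
  have hinj : Function.Injective word := by
    intro s t h
    ext j
    have hj := congr_fun h j
    simp only [hword] at hj
    by_cases hs : j ∈ s <;> by_cases ht : j ∈ t <;> simp_all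
  -- letter counts: `∏ⱼ v (word s j) = (v 0)^{#s} · (v 1)^{n − #s}`
  have hprod : ∀ (v : Fin 2 → ℕ) (s : Finset (Fin n)),
      ∏ j, v (word s j) = v 0 ^ s.card * v 1 ^ (n - s.card) := by
    intro v s
    have h : ∀ j, v (word s j) = if j ∈ s then v 0 else v 1 := by
      intro j
      simp only [hword]
      split_ifs <;> rfl
    simp_rw [h]
    rw [Finset.prod_ite, Finset.prod_const, Finset.prod_const]
    congr 2
    · congr 1
      ext j
      simp
    · have hc : (Finset.univ.filter fun j : Fin n => j ∉ s) = sᶜ := by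
        ext j
        simp
      rw [hc, Finset.card_compl, Fintype.card_fin]
  have hmem : ∀ β : Fin (n.choose 2), ((e.symm β : Finset (Fin n))).card = 2 := fun β =>
    (Finset.mem_powersetCard.1 (e.symm β).2).2
  refine ⟨fun β => word (e.symm β), ?_, ?_, ?_⟩
  · intro β β' h
    exact e.symm.injective (Subtype.ext (hinj h))
  · intro β
    show ∏ j, (![n, 1] : Fin 2 → ℕ) (word (e.symm β) j) = n ^ 2
    rw [hprod, hmem]
    simp
  · intro β
    show ∏ j, (![1, (n - 1) * (n - 1)] : Fin 2 → ℕ) (word (e.symm β) j) = ((n - 1) * (n - 1)) ^ (n - 2)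
    rw [hprod, hmem]
    simp

variable (K : Type u) [Field K]

/-- **`E_n^{⊗n} ≥ C(n,2) ⊙ ⟨n², (n−1)^{2(n−2)}, n²⟩`**, `E_n = ⟨n,1,n⟩ ⊕ ⟨1,(n−1)²,1⟩`: the block of
the words of type `(2, n−2)` (Example 3.2 with `k = n` at `u = 2/n`), a restriction by the tree's
block extraction `tensorRestrictsTo_kroneckerPow_matMulDirectSum_multiple` (Bläser 2013, proof of
Thm. 7.5). [cite: LottiRomani1983, Prop. 4.1 (proof, p. 181)] [cite: Blaser2013, Thm. 7.5 (proof)] -/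
theorem tensorRestrictsTo_schoenhagePow_twoBlock (n : ℕ) :
    TensorRestrictsTo
      (kroneckerPow (matMulDirectSum K ![n, 1] ![1, (n - 1) * (n - 1)] ![n, 1]) n)
      (kroneckerTensor (unitTensor K (n.choose 2))
        (matMulTensor K (n ^ 2) (((n - 1) * (n - 1)) ^ (n - 2)) (n ^ 2))) := by
  obtain ⟨rep, hrep, hK, hM⟩ := exists_typeTwoWords n
  exact tensorRestrictsTo_kroneckerPow_matMulDirectSum_multiple K _ _ _ rep hrep hK hM hK

/-- **`R_{2n}(C(n,2) ⊙ ⟨n², (n−1)^{2(n−2)}, n²⟩) ≤ (n² + 1)^n`** (`n ≥ 1`): restriction of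
`E_n^{⊗n}`, `R_{2n}(E_n^{⊗n}) ≤ R₂(E_n)^n`, and Schönhage's `R₂(E_n) ≤ n² + 1`.
[cite: LottiRomani1983, Example 3.2 (p. 177) and Prop. 4.1 (proof, p. 181)]
[cite: BurgisserClausenShokrollahi1997, (15.12)] -/
theorem approxRank_twoBlock_le {n : ℕ} (hn : 1 ≤ n) :
    approxRank (n * 2) (kroneckerTensor (unitTensor K (n.choose 2))
        (matMulTensor K (n ^ 2) (((n - 1) * (n - 1)) ^ (n - 2)) (n ^ 2))) ≤ (n * n + 1) ^ n := by
  classical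
  refine ((tensorRestrictsTo_schoenhagePow_twoBlock K n).approxRank_le (n * 2)).trans ?_
  refine (approxRank_kroneckerPow_le 2 _ n).trans ?_
  exact Nat.pow_le_pow_left (approxRank_two_schoenhageExample_le K hn hn) n

/-- **`R̃(C(n,2) ⊙ ⟨n², (n−1)^{2(n−2)}, n²⟩) ≤ (n² + 1)^n`** (`n ≥ 1`; `R̃ ≤ R_h`).
[cite: LottiRomani1983, Prop. 4.1 (proof, p. 181)] -/
theorem asymptoticRank_twoBlock_le {n : ℕ} (hn : 1 ≤ n) :
    asymptoticRank (kroneckerTensor (unitTensor K (n.choose 2))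
        (matMulTensor K (n ^ 2) (((n - 1) * (n - 1)) ^ (n - 2)) (n ^ 2))) ≤
      (((n * n + 1) ^ n : ℕ) : ℝ) := by
  classical
  refine (asymptoticRank_le_approxRank (n * 2) _).trans ?_
  exact_mod_cast approxRank_twoBlock_le K hn

end Block

/-! ## The rectangular asymptotic sum inequality on the block: `f(x_n)` bounded -/

section Analysis

variable (K : Type) [Field K]

/-- The middle dimension `(n−1)^{2(n−2)} ≥ 1` for `n ≥ 2`. [folklore] -/
private theorem one_le_midDim {n : ℕ} (hn : 2 ≤ n) : 1 ≤ ((n - 1) * (n - 1)) ^ (n - 2) :=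
  Nat.one_le_pow _ _ (Nat.mul_pos (by omega) (by omega))

/-- **Lotti–Romani's abscissa `x_n = (n−2) ln(n−1) / ln n` is `log_{n²} ((n−1)^{2(n−2)})`**, i.e.
the middle dimension of the block `⟨n², (n−1)^{2(n−2)}, n²⟩` is `(n²)^{x_n}` (`n ≥ 2`).
[cite: LottiRomani1983, Prop. 4.1 (proof, p. 181: `x_n = (n−2) ln(n−1)/ln n`)] -/
theorem lrAbscissa_eq_logb {n : ℕ} (hn : 2 ≤ n) :
    ((n : ℝ) - 2) * Real.log ((n : ℝ) - 1) / Real.log n =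
      Real.logb ((n : ℝ) ^ 2) ((((n - 1) * (n - 1)) ^ (n - 2) : ℕ) : ℝ) := by
  unfold Real.logb
  have h1 : (1 : ℕ) ≤ n := by omega
  have hn1 : (0 : ℝ) < (n : ℝ) - 1 := by
    have : (2 : ℝ) ≤ n := by exact_mod_cast hn
    linarith
  rw [Nat.cast_pow, Nat.cast_mul, Nat.cast_sub h1, Nat.cast_one, Real.log_pow, Real.log_pow,
    Real.log_mul hn1.ne' hn1.ne']
  push_cast [Nat.cast_sub hn]
  ring

/-- `x_n ≥ 0` (`n ≥ 2`). [cite: LottiRomani1983, Prop. 4.1 (proof, p. 181)] -/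
theorem lrAbscissa_nonneg {n : ℕ} (hn : 2 ≤ n) :
    0 ≤ ((n : ℝ) - 2) * Real.log ((n : ℝ) - 1) / Real.log n := by
  rw [lrAbscissa_eq_logb hn]
  refine Real.logb_nonneg ?_ ?_
  · have h2 : (2 : ℝ) ≤ n := by exact_mod_cast hn
    nlinarith
  · exact_mod_cast one_le_midDim hn

/-- `(n²)^{x_n} = (n−1)^{2(n−2)}` (`n ≥ 2`). [cite: LottiRomani1983, Prop. 4.1 (proof, p. 181)] -/
theorem rpow_lrAbscissa {n : ℕ} (hn : 2 ≤ n) :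
    ((n : ℝ) ^ 2) ^ (((n : ℝ) - 2) * Real.log ((n : ℝ) - 1) / Real.log n) =
      ((((n - 1) * (n - 1)) ^ (n - 2) : ℕ) : ℝ) := by
  rw [lrAbscissa_eq_logb hn]
  have h2 : (2 : ℝ) ≤ n := by exact_mod_cast hn
  refine Real.rpow_logb (by positivity) ?_ ?_
  · nlinarith
  · exact_mod_cast one_le_midDim hn

/-- **The asymptotic sum inequality on the type-`(2,n−2)` block** (Lotti–Romani's
`B(u ln n, 2(1−u) ln(n−1), u ln n) ≤ ln(1+n²) + …` at `u = 2/n`, finite-power form):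
`C(n,2) · (n²)^{ω_K(1, x_n, 1)} ≤ (n² + 1)^n` for `n ≥ 2`, over every field.
[cite: LottiRomani1983, Prop. 4.1 (proof, p. 181)] [cite: AlmanDuanVassilevskaWilliamsXuXuZhou2025, Thm. 3.2] -/
theorem choose_mul_rpow_omegaRect_lrAbscissa_le {n : ℕ} (hn : 2 ≤ n) :
    ((n.choose 2 : ℕ) : ℝ) *
        ((n : ℝ) ^ 2) ^ omegaRect K 1 (((n : ℝ) - 2) * Real.log ((n : ℝ) - 1) / Real.log n) 1 ≤
      (((n * n + 1) ^ n : ℕ) : ℝ) := by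
  have ht : 1 ≤ n.choose 2 := Nat.choose_pos hn
  have ha : 2 ≤ n ^ 2 := by nlinarith
  have haB : ((n ^ 2 : ℕ) : ℝ) ^ (((n : ℝ) - 2) * Real.log ((n : ℝ) - 1) / Real.log n) ≤
      ((((n - 1) * (n - 1)) ^ (n - 2) : ℕ) : ℝ) := by
    exact_mod_cast (rpow_lrAbscissa hn).le
  have h1 := mul_rpow_omegaRect_mid_le_asymptoticRank K (lrAbscissa_nonneg hn) ht ha haB
  have h2 := asymptoticRank_twoBlock_le K (by omega : 1 ≤ n)
  push_cast at h1
  exact h1.trans h2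

/-- **`f(x_n) − x_n ≤ 1 + 9 / (2 ln n)`** for `n ≥ 2`, over every field (Lotti–Romani:
`y_n − x_n = 1 + O(1/ln n)`): take logarithms in `choose_mul_rpow_omegaRect_lrAbscissa_le`,
`ln C(n,2) + 2 ln n · f(x_n) ≤ n ln(n²+1)`, `2 ln n · x_n = 2(n−2) ln(n−1)`, and
`n ln((n²+1)/(n−1)²) ≤ 2n²/(n−1)² ≤ 8`, `ln(n−1) ≤ ln n`, `ln 2 ≤ 1`.
[cite: LottiRomani1983, Prop. 4.1 (proof, p. 181)] -/
theorem omegaRect_lrAbscissa_sub_le {n : ℕ} (hn : 2 ≤ n) :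
    omegaRect K 1 (((n : ℝ) - 2) * Real.log ((n : ℝ) - 1) / Real.log n) 1 -
        ((n : ℝ) - 2) * Real.log ((n : ℝ) - 1) / Real.log n ≤ 1 + 9 / (2 * Real.log n) := by
  set x : ℝ := ((n : ℝ) - 2) * Real.log ((n : ℝ) - 1) / Real.log n with hxdef
  set W := omegaRect K 1 x 1 with hW
  set a : ℝ := (n : ℝ) with ha
  have ha2 : (2 : ℝ) ≤ a := by rw [ha]; exact_mod_cast hn
  have ha1 : 0 < a - 1 := by linarith
  have hapos : 0 < a := by linarith
  have hL : 0 < Real.log a := Real.log_pos (by linarith)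
  -- the multiplicity `C(n,2) = n(n−1)/2`
  have hC : ((n.choose 2 : ℕ) : ℝ) = a * (a - 1) / 2 := by
    rw [Nat.cast_choose_two]
  have hCpos : 0 < a * (a - 1) / 2 := by positivity
  -- the inequality of the previous theorem, with real casts
  have h0 := choose_mul_rpow_omegaRect_lrAbscissa_le K hn
  rw [hC] at h0
  have hR : (((n * n + 1) ^ n : ℕ) : ℝ) = (a * a + 1) ^ n := by push_cast; rw [ha]
  rw [hR] at h0
  have hpow : 0 < (a ^ 2) ^ W := Real.rpow_pos_of_pos (by positivity) W
  -- take logarithms: `ln C + W · ln(n²) ≤ n · ln(n² + 1)`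
  have hlog := Real.log_le_log (mul_pos hCpos hpow) h0
  rw [Real.log_mul hCpos.ne' hpow.ne', Real.log_rpow (by positivity), Real.log_pow,
    Real.log_div (by positivity) two_ne_zero, Real.log_mul hapos.ne' ha1.ne', Real.log_pow] at hlog
  simp only [Nat.cast_ofNat] at hlog
  -- `2 ln n · x_n = 2 (n−2) ln(n−1)`
  have hx : 2 * Real.log a * x = 2 * ((a - 2) * Real.log (a - 1)) := by
    rw [hxdef]
    field_simp
  -- elementary estimates
  have e1 : Real.log (a * a + 1) - 2 * Real.log (a - 1) ≤ 2 * a / (a - 1) ^ 2 := by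
    have h : Real.log ((a * a + 1) / (a - 1) ^ 2) ≤ (a * a + 1) / (a - 1) ^ 2 - 1 :=
      Real.log_le_sub_one_of_pos (by positivity)
    rw [Real.log_div (by positivity) (by positivity), Real.log_pow] at h
    have h' : (a * a + 1) / (a - 1) ^ 2 - 1 = 2 * a / (a - 1) ^ 2 := by
      field_simp
      ring
    push_cast at h
    linarith
  have e2 : a * (2 * a / (a - 1) ^ 2) ≤ 8 := by
    rw [← mul_div_assoc, div_le_iff₀ (by positivity)]
    nlinarith [mul_nonneg (sub_nonneg.2 ha2) (by linarith : (0 : ℝ) ≤ 6 * a - 4)]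
  have e3 : a * (Real.log (a * a + 1) - 2 * Real.log (a - 1)) ≤ 8 :=
    (mul_le_mul_of_nonneg_left e1 hapos.le).trans e2
  have e4 : Real.log (a - 1) ≤ Real.log a := Real.log_le_log ha1 (by linarith)
  have e5 : Real.log 2 ≤ 1 := by
    have := Real.log_le_sub_one_of_pos (zero_lt_two' ℝ)
    linarith
  -- assemble: `2 ln n · (W − x_n) ≤ 2 ln n + 9`
  have key : 2 * Real.log a * (W - x) ≤ 2 * Real.log a + 9 := by
    have hn' : (n : ℝ) = a := ha.symm
    rw [mul_sub, hx]
    rw [hn'] at hlog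
    nlinarith [hlog, e3, e4, e5, hL]
  have h2L : 0 < 2 * Real.log a := by positivity
  rw [show (1 : ℝ) + 9 / (2 * Real.log a) = (2 * Real.log a + 9) / (2 * Real.log a) by
    field_simp]
  rw [le_div_iff₀ h2L]
  linarith

/-! ## Prop. 4.1 -/

/-- **`f` comes `ε`-close to `x + 1`**: for every field `K` and every `ε > 0` there is `x ≥ 0` with
`ω_K(1, x, 1) ≤ x + 1 + ε` (take `x = x_n` with `ln n ≥ 9/(2ε)`).
[cite: LottiRomani1983, Prop. 4.1 (pp. 180–181)] -/
theorem exists_omegaRect_one_mid_one_le {ε : ℝ} (hε : 0 < ε) :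
    ∃ x : ℝ, 0 ≤ x ∧ omegaRect K 1 x 1 ≤ x + 1 + ε := by
  set n : ℕ := ⌈Real.exp (9 / (2 * ε))⌉₊ + 2 with hn
  have hn2 : 2 ≤ n := by omega
  have hexp : Real.exp (9 / (2 * ε)) ≤ (n : ℝ) := by
    refine (Nat.le_ceil _).trans ?_
    rw [hn]
    push_cast
    linarith
  have hlog : 9 / (2 * ε) ≤ Real.log n := by
    rw [← Real.log_exp (9 / (2 * ε))]
    exact Real.log_le_log (Real.exp_pos _) hexp
  have hL : 0 < Real.log n := lt_of_lt_of_le (by positivity) hlog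
  have h9 : 9 / (2 * Real.log n) ≤ ε := by
    rw [div_le_iff₀ (by positivity)]
    have := (div_le_iff₀ (by positivity : (0 : ℝ) < 2 * ε)).1 hlog
    linarith
  refine ⟨_, lrAbscissa_nonneg hn2, ?_⟩
  have := omegaRect_lrAbscissa_sub_le K hn2
  linarith

/-- **Prop. 4.1, eventual form, every field**: for every `ε > 0` there is `k₀` with
`ω_K(1, k, 1) ≤ k + 1 + ε` for all `k ≥ k₀` («`f(x)` is arbitrarily close to the lower bound `x + 1`
for sufficiently large `x`», p. 180; by §2's antitonicity of `f(x) − x`).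
[cite: LottiRomani1983, Prop. 4.1 (pp. 180–181); §2 (p. 174)] -/
theorem omegaRect_one_mid_one_eventually_le (ε : ℝ) (hε : 0 < ε) :
    ∃ k₀ : ℝ, ∀ k ≥ k₀, omegaRect K 1 k 1 ≤ k + 1 + ε := by
  obtain ⟨x, -, hx⟩ := exists_omegaRect_one_mid_one_le K hε
  refine ⟨x, fun k hk => ?_⟩
  have hmono := omegaRect_one_mid_one_sub_antitone K hk
  simp only at hmono
  linarith

/-- **`ω_K(1, x, 1) − x → 1` as `x → ∞`**, every field. [cite: LottiRomani1983, Prop. 4.1 (pp. 180–181); §2 (p. 174)] -/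
theorem tendsto_omegaRect_one_mid_one_sub :
    Tendsto (fun x : ℝ => omegaRect K 1 x 1 - x) atTop (𝓝 1) := by
  rw [Metric.tendsto_atTop]
  intro ε hε
  obtain ⟨k₀, hk₀⟩ := omegaRect_one_mid_one_eventually_le K (ε / 2) (half_pos hε)
  refine ⟨k₀, fun x hx => ?_⟩
  have h₁ := one_le_omegaRect_one_mid_one_sub K x
  have h₂ := hk₀ x hx
  rw [Real.dist_eq, abs_lt]
  constructor <;> linarith

/-- **Prop. 4.1 for every field: `liminf_{x→∞} (ω_K(1,x,1) − x) = 1`.**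
[cite: LottiRomani1983, Prop. 4.1 (pp. 180–181); §2 (p. 174)] -/
theorem liminf_omegaRect_one_mid_one_sub_eq_one :
    Filter.liminf (fun x : ℝ => omegaRect K 1 x 1 - x) atTop = 1 :=
  (tendsto_omegaRect_one_mid_one_sub K).liminf_eq

/-- **Lotti–Romani 1983, Prop. 4.1 — the named fact `LottiRomani1983_prop41` HOLDS**:
`inf_{x→∞} [f(x) − x] = 1` for `f(x) = ω_ℂ(1, x, 1)`.
[cite: LottiRomani1983, Prop. 4.1 (pp. 180–181)] [cite: Coppersmith1982, p. 471] -/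
theorem LottiRomani1983_prop41_holds : LottiRomani1983_prop41 :=
  liminf_omegaRect_one_mid_one_sub_eq_one ℂ

end Analysis

/-! ## Coppersmith's statement of Prop. 4.1 (SIAM J. Comput. 11 (1982), p. 471) -/

section Coppersmith

variable (K : Type) [Field K]

/-- **Coppersmith 1982, p. 471 (the statement Lotti–Romani prove as Prop. 4.1), in the tree's rank-exponent currency,
over every field:** for each `β > 0` there is an `α > 1` such that `α + 1 + β` is an admissible exponent of
`⟨N, N, ⌈N^α⌉⟩`, i.e. `R(⟨N, N, ⌈N^α⌉⟩) = O(N^{α+1+β})` — from `omegaRect_one_mid_one_eventually_le` (`ω(1,α,1) ≤ α + 1 + β/2`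
for `α` large), the symmetry `ω(1,α,1) = ω(1,1,α)` (`omegaRect_one_mid_one`) and `ω = inf` of the (upward closed) admissible
set. WEAKER than print only in dropping Coppersmith's sharper `O(N^{α+1+β}(log N)^{3/2})` for his specific `α(β)`: here `β > 0` is
arbitrary, so the logarithmic factor is absorbed. [cite: Coppersmith1982, p. 471 (closing remarks)]
[cite: LottiRomani1983, Prop. 4.1 (pp. 180–181)] -/
theorem Coppersmith1982_exists_mem_rectAdmissibleExponents {β : ℝ} (hβ : 0 < β) :
    ∃ α : ℝ, 1 < α ∧ α + 1 + β ∈ rectAdmissibleExponents K 1 1 α := by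
  obtain ⟨k₀, hk₀⟩ := omegaRect_one_mid_one_eventually_le K (β / 2) (half_pos hβ)
  refine ⟨max k₀ 2, by
    have := le_max_right k₀ 2
    linarith, ?_⟩
  set α : ℝ := max k₀ 2 with hα
  have h1 : omegaRect K 1 1 α ≤ α + 1 + β / 2 := by
    rw [← omegaRect_one_mid_one]
    exact hk₀ α (le_max_left _ _)
  have hlt : sInf (rectAdmissibleExponents K 1 1 α) < α + 1 + β := by
    have : omegaRect K 1 1 α < α + 1 + β := by linarith
    simpa [omegaRect] using this
  obtain ⟨γ, hγ, hγlt⟩ := exists_lt_of_csInf_lt (rectAdmissibleExponents_nonempty K 1 1 α) hlt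
  exact mem_rectAdmissibleExponents_of_le hγ hγlt.le

/-- The same, unfolded: **`R(⟨N, N, ⌈N^α⌉⟩) = O(N^{α + 1 + β})` for some `α > 1`** (`rectDim n 1 = n`).
[cite: Coppersmith1982, p. 471 (closing remarks)] -/
theorem Coppersmith1982_exists_isBigO_tensorRank_matMulTensor {β : ℝ} (hβ : 0 < β) :
    ∃ α : ℝ, 1 < α ∧
      (fun n : ℕ => (tensorRank (matMulTensor K n n (rectDim n α)) : ℝ)) =O[atTop]
        fun n : ℕ => (n : ℝ) ^ (α + 1 + β) := by
  obtain ⟨α, hα, hmem⟩ := Coppersmith1982_exists_mem_rectAdmissibleExponents K hβ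
  refine ⟨α, hα, ?_⟩
  have hfun : (fun n : ℕ => (tensorRank (matMulTensor K (rectDim n 1) (rectDim n 1) (rectDim n α)) : ℝ)) =
      fun n : ℕ => (tensorRank (matMulTensor K n n (rectDim n α)) : ℝ) := by
    funext n
    rw [tensorRank_matMulTensor_congr (K := K) (rectDim_one n) (rectDim_one n) rfl]
  rw [← hfun]
  exact hmem

end Coppersmith

end Literature.Computability.AlgebraicComplexity

end
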